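import Literature.Barriers.RiemannHypothesis.TuranPartialSumsShiftCheckSound
import Literature.Barriers.RiemannHypothesis.TuranPartialSumsShiftZero
import Literature.Barriers.RiemannHypothesis.TuranPartialSumsShiftRun1
import Literature.Barriers.RiemannHypothesis.TuranPartialSumsShiftRun2
import Literature.Barriers.RiemannHypothesis.TuranPartialSumsShiftRun3
import HarnessLib

/-!
# Sections of `ζ` beyond `σ = 1`: every `ζ_N`, `N ≥ 360000`, has a zero with `σ > 1`

Barrier catalogue `Literature/Barriers/RiemannHypothesis/`. Assembly of the vertical-shift
construction: the three certified runs (`cover1_ok`, `cover2_ok`, `cover3_ok`) accept the `85`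
cells of `TuranPartialSumsShiftCover.lean`; these cells cover `log N` for every `N ≥ 360000`
(`exists_cell`); the soundness theorem `criterion_of_checkCell` turns acceptance into
`‖Bval N‖ < Rval N` plus the side condition; and `exists_zero_of_Bval_lt_Rval` turns that into a
zero of `ζ_N(s) = ∑_{n ≤ N} n^{-s}` with `Re s > 1`.

## Main result

* `exists_zero_re_gt_one_of_ge : 360000 ≤ N → ∃ s, 1 < s.re ∧ zetaPartialSum N s = 0`.

Axioms: `propext`, `Classical.choice`, `Quot.sound` and the three `native_decide` auxiliary axioms
of `cover1_ok`, `cover2_ok`, `cover3_ok` (trust in the Lean compiler; declared `computational`).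

## References

* The construction and all estimates are the tree's (`TuranPartialSumsShift*.lean`); the criterion
  is [PlattTrudgian2016, §2.2] / [Montgomery1983, §2] as formalized in
  `TuranPartialSumsCriterion.lean`.
-/

noncomputable section

open Real

namespace Literature.Barriers.RiemannHypothesis

namespace TuranShift

namespace Cert

/-- Every cell produced by `cellsBetween` has denominator `100`. [folklore] -/
theorem d_of_mem_cellsBetween : ∀ (l : List ℕ) {c : Cell}, c ∈ cellsBetween l → c.d = 100
  | [], c, h => by simp [cellsBetween] at h
  | [_], c, h => by simp [cellsBetween] at h
  | a :: b :: rest, c, h => by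
    simp only [cellsBetween, List.mem_cons] at h
    rcases h with rfl | h
    · rfl
    · exact d_of_mem_cellsBetween (b :: rest) h

/-- **The cells between consecutive break points cover the whole range.** [folklore] -/
theorem exists_mem_cellsBetween : ∀ (a b : ℕ) (rest : List ℕ) {x : ℝ}, (a : ℝ) ≤ x →
    x ≤ (((b :: rest).getLast (List.cons_ne_nil b rest) : ℕ) : ℝ) →
    ∃ c ∈ cellsBetween (a :: b :: rest), (c.n1 : ℝ) ≤ x ∧ x ≤ (c.n2 : ℝ)
  | a, b, [], x, ha, hb => ⟨⟨a, b, 100⟩, by simp [cellsBetween], ha, by simpa using hb⟩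
  | a, b, e :: rest, x, ha, hb => by
    by_cases hxb : x ≤ (b : ℝ)
    · exact ⟨⟨a, b, 100⟩, by simp [cellsBetween], ha, hxb⟩
    · have hb' : x ≤ (((e :: rest).getLast (List.cons_ne_nil e rest) : ℕ) : ℝ) := by
        rwa [List.getLast_cons (List.cons_ne_nil e rest)] at hb
      obtain ⟨c, hc, h1, h2⟩ := exists_mem_cellsBetween b e rest (le_of_lt (not_le.1 hxb)) hb'
      exact ⟨c, List.mem_cons_of_mem _ hc, h1, h2⟩

/-- `e^{12.75} ≤ 360000`. [folklore] -/
theorem exp_1275_le : Real.exp (1275 / 100) ≤ 360000 := by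
  have h4 : Real.exp (1275 / 100) ^ 4 = Real.exp 1 ^ 51 := by
    rw [← Real.exp_nat_mul, ← Real.exp_nat_mul]; norm_num
  have h1 : Real.exp 1 ^ 51 ≤ (2.7182818286 : ℝ) ^ 51 :=
    pow_le_pow_left₀ (Real.exp_pos 1).le Real.exp_one_lt_d9.le 51
  have h2 : (2.7182818286 : ℝ) ^ 51 ≤ (360000 : ℝ) ^ 4 := by norm_num
  have h3 : Real.exp (1275 / 100) ^ 4 ≤ (360000 : ℝ) ^ 4 := by rw [h4]; exact h1.trans h2
  exact (pow_le_pow_iff_left₀ (Real.exp_pos _).le (by norm_num) (by norm_num)).1 h3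

/-- **The cover.** For every `N ≥ 360000` some accepted cell contains `log N`. [folklore] -/
theorem exists_cell {N : ℕ} (hN : 360000 ≤ N) :
    ∃ c : Cell, checkCell c = true ∧ (c.n1 : ℝ) ≤ c.d * Real.log N ∧
      (c.n2 ≠ 0 → (c.d : ℝ) * Real.log N ≤ c.n2) := by
  set x : ℝ := 100 * Real.log N with hx
  have hN0 : (0 : ℝ) < N := by exact_mod_cast (by omega : 0 < N)
  have hx0 : (1275 : ℝ) ≤ x := by
    rw [hx]
    have : (1275 : ℝ) / 100 ≤ Real.log N := by
      rw [Real.le_log_iff_exp_le hN0]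
      exact exp_1275_le.trans (by exact_mod_cast hN)
    linarith
  have h1 := List.all_eq_true.1 cover1_ok
  have h2 := List.all_eq_true.1 cover2_ok
  have h3 := List.all_eq_true.1 cover3_ok
  -- locate `x`
  by_cases hA : x ≤ 1942
  · obtain ⟨c, hc, hc1, hc2⟩ := exists_mem_cellsBetween 1275 1291 (breaks1.drop 2) hx0
      (by simpa [breaks1] using hA)
    have e : cellsBetween (1275 :: 1291 :: breaks1.drop 2) = cover1 := by decide
    have hc' : c ∈ cover1 := e ▸ hc
    have hd : c.d = 100 := d_of_mem_cellsBetween _ hc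
    exact ⟨c, h1 c hc', by rw [hd]; push_cast; linarith, fun _ ↦ by rw [hd]; push_cast; linarith⟩
  by_cases hB : x ≤ 4088
  · obtain ⟨c, hc, hc1, hc2⟩ := exists_mem_cellsBetween 1942 1979 (breaks2.drop 2) (le_of_lt (not_le.1 hA))
      (by simpa [breaks2] using hB)
    have e : cellsBetween (1942 :: 1979 :: breaks2.drop 2) = cover2 := by decide
    have hc' : c ∈ cover2 := e ▸ hc
    have hd : c.d = 100 := d_of_mem_cellsBetween _ hc
    exact ⟨c, h2 c hc', by rw [hd]; push_cast; linarith, fun _ ↦ by rw [hd]; push_cast; linarith⟩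
  by_cases hC : x ≤ 372069
  · obtain ⟨c, hc, hc1, hc2⟩ := exists_mem_cellsBetween 4088 4255 (breaks3.drop 2) (le_of_lt (not_le.1 hB))
      (by simpa [breaks3] using hC)
    have e : cellsBetween (4088 :: 4255 :: breaks3.drop 2) = cellsBetween breaks3 := by decide
    have hc' : c ∈ cover3 := List.mem_append_left _ (e ▸ hc)
    have hd : c.d = 100 := d_of_mem_cellsBetween _ hc
    exact ⟨c, h3 c hc', by rw [hd]; push_cast; linarith, fun _ ↦ by rw [hd]; push_cast; linarith⟩
  · refine ⟨lastCell, h3 lastCell (by simp [cover3]), ?_, fun h ↦ absurd rfl h⟩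
    simp only [lastCell]
    push_cast
    linarith

/-- **Every section `ζ_N`, `N ≥ 360000`, has a zero in the half-plane `σ > 1`** (the vertical-shift
construction: phases `p^{-iτ}`, `τ = (29/4)/log N`, on the primes `p ≤ √N`; explicit prime bounds;
certified interval evaluation of the resulting inequality `‖B‖ < R`). [folklore] -/
theorem exists_zero_re_gt_one_of_ge {N : ℕ} (hN : 360000 ≤ N) :
    ∃ s : ℂ, 1 < s.re ∧ zetaPartialSum N s = 0 := by
  obtain ⟨c, hc, hL1, hL2⟩ := exists_cell hN
  obtain ⟨hB, hside⟩ := criterion_of_checkCell hc hN hL1 hL2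
  exact exists_zero_of_Bval_lt_Rval hB hside

end Cert

end TuranShift

end Literature.Barriers.RiemannHypothesis
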